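import Summits.ABC.ABC.Theorems.TwistAmplificationSharpModerateLawDeepRegimeCalibrationLemmas

/-!
# Crux `TwistAmplification.SharpModerateLaw` (stmt-ABC-1975), line `deep-moduli-cusp-dispersion`:
injectivity of the twisted Frey pair (summit calibration "deep-regime law ⇒ ABC", piece a0)

The summit calibration injects Frey–twist data `(a, b, d)` (a coprime pair `(a, b)` of positive
integers and a twist `d = 1` or a prime) into the deep-regime sets through the TWISTED Frey pair
`x(a,b,d) = (d²·c₄(a,b), d³·c₆(a,b))`, where `freyPair a b = (c₄, c₆) = (16(a²+ab+b²), −32(b−a)(2a+b)(a+2b))`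
(`…SharpModerateLawFreyPairs.lean`).  This file proves the registered sub-goal `twistedFreyPair_inj`:
`(a, b, d) ↦ x(a,b,d)` is injective on such data (the counting worker consumes it as a hypothesis).

Proof.  Write `A = a²+ab+b²`, `m = ab(a+b)`.  The coordinate equalities give `d²A = d'²A'` and, through
the syzygy `c₄³ − c₆² = 1728·16·m²` (`freyPair_cube_sub_sq`), `(d³m)² = (d'³m')²`, so `d³m = d'³m'`
(`twistedFreyPair_eqs`).  If `d ≠ d'`, one of the two twists, say `d`, is a prime not dividing the
other, hence `d ∣ A'` and `d ∣ m'` — impossible for coprime `(a', b')` (`not_dvd_freyA_of_dvd_abc`;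
`twistedFreyPair_noCollision`).  So `d = d' ≠ 0`, the twist cancels, and `freyPair_inj` recovers `(a, b)`.
(The hypotheses `gcd(d, ab(a+b)) = 1` of the registered signature are not needed.)
-/

noncomputable section

set_option linter.dupNamespace false

namespace Summit.ABC.ABC.Theorems.SharpModerateLaw.CuspDispersion

/-- The two coordinate equalities of twisted Frey pairs, stripped of their constants:
`d²·A = d'²·A'` and `d³·m = d'³·m'` (`A = a²+ab+b²`, `m = ab(a+b)`; the second one from
`d⁶(c₄³ − c₆²) = d'⁶(c₄'³ − c₆'²)` and the syzygy `c₄³ − c₆² = 27648·m²`, taking the nonnegative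
square root). -/
theorem twistedFreyPair_eqs {a b d a' b' d' : ℕ}
    (h1 : (d : ℤ) ^ 2 * (freyPair a b).1 = (d' : ℤ) ^ 2 * (freyPair a' b').1)
    (h2 : (d : ℤ) ^ 3 * (freyPair a b).2 = (d' : ℤ) ^ 3 * (freyPair a' b').2) :
    (d : ℤ) ^ 2 * freyA a b = (d' : ℤ) ^ 2 * freyA a' b' ∧
      (d : ℤ) ^ 3 * ((a : ℤ) * b * (a + b)) = (d' : ℤ) ^ 3 * ((a' : ℤ) * b' * (a' + b')) := by
  constructor
  · rw [freyPair_fst, freyPair_fst] at h1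
    linarith
  · have e := freyPair_cube_sub_sq a b
    have e' := freyPair_cube_sub_sq a' b'
    have h1c : ((d : ℤ) ^ 2 * (freyPair a b).1) ^ 3 = ((d' : ℤ) ^ 2 * (freyPair a' b').1) ^ 3 := by
      rw [h1]
    have h2s : ((d : ℤ) ^ 3 * (freyPair a b).2) ^ 2 = ((d' : ℤ) ^ 3 * (freyPair a' b').2) ^ 2 := by
      rw [h2]
    have hsq : ((d : ℤ) ^ 3 * ((a : ℤ) * b * (a + b))) ^ 2 =
        ((d' : ℤ) ^ 3 * ((a' : ℤ) * b' * (a' + b'))) ^ 2 := by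
      have h27 : (27648 : ℤ) * ((d : ℤ) ^ 3 * ((a : ℤ) * b * (a + b))) ^ 2 =
          27648 * ((d' : ℤ) ^ 3 * ((a' : ℤ) * b' * (a' + b'))) ^ 2 := by
        linear_combination h1c - h2s - (d : ℤ) ^ 6 * e + (d' : ℤ) ^ 6 * e'
      exact mul_left_cancel₀ (by norm_num) h27
    have hx : (0 : ℤ) ≤ (d : ℤ) ^ 3 * ((a : ℤ) * b * (a + b)) := by positivity
    have hy : (0 : ℤ) ≤ (d' : ℤ) ^ 3 * ((a' : ℤ) * b' * (a' + b')) := by positivity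
    exact (pow_left_inj₀ hx hy two_ne_zero).mp hsq

/-- No collision between a prime twist `d` and a twist `d' ≠ d` (`d' = 1` or a prime): `d ∤ d'`, so
`d²·A = d'²·A'` and `d³·m = d'³·ab(a'+b')` force `d ∣ A'` and `d ∣ a'b'(a'+b')`, impossible for coprime
`(a', b')` (`not_dvd_freyA_of_dvd_abc`). -/
theorem twistedFreyPair_noCollision {a' b' d d' : ℕ} {A m : ℤ} (hab' : Nat.Coprime a' b')
    (hd : d.Prime) (hne : d ≠ d') (hd' : d' = 1 ∨ d'.Prime)
    (hE1 : (d : ℤ) ^ 2 * A = (d' : ℤ) ^ 2 * freyA a' b')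
    (hE2 : (d : ℤ) ^ 3 * m = (d' : ℤ) ^ 3 * ((a' : ℤ) * b' * (a' + b'))) : False := by
  have hp : Prime (d : ℤ) := Nat.prime_iff_prime_int.mp hd
  have hndvd : ¬ (d : ℤ) ∣ (d' : ℤ) := by
    intro h
    have h' : d ∣ d' := Int.natCast_dvd_natCast.mp h
    rcases hd' with rfl | hd'
    · exact hd.ne_one (Nat.dvd_one.mp h')
    · exact hne ((Nat.prime_dvd_prime_iff_eq hd hd').mp h')
  have hA : (d : ℤ) ∣ freyA a' b' := by
    have h : (d : ℤ) ∣ (d' : ℤ) ^ 2 * freyA a' b' := ⟨(d : ℤ) * A, by rw [← hE1]; ring⟩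
    rcases hp.dvd_or_dvd h with h | h
    · exact absurd (hp.dvd_of_dvd_pow h) hndvd
    · exact h
  have hm : (d : ℤ) ∣ (a' : ℤ) * b' * (a' + b') := by
    have h : (d : ℤ) ∣ (d' : ℤ) ^ 3 * ((a' : ℤ) * b' * (a' + b')) :=
      ⟨(d : ℤ) ^ 2 * m, by rw [← hE2]; ring⟩
    rcases hp.dvd_or_dvd h with h | h
    · exact absurd (hp.dvd_of_dvd_pow h) hndvd
    · exact h
  exact not_dvd_freyA_of_dvd_abc hab' hd hA hm

/-- Registered sub-goal `twistedFreyPair_inj` of stmt-ABC-1975 (summit calibration "deep-regime law ⇒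
ABC", piece a0, line `deep-moduli-cusp-dispersion`): the twisted Frey pair
`(a, b, d) ↦ (d²·c₄(a,b), d³·c₆(a,b))` is injective on Frey–twist data (`a, b > 0` coprime, `d = 1` or
a prime coprime to `ab(a+b)`). -/
theorem twistedFreyPair_inj : ∀ a b d a' b' d' : ℕ, 0 < a → 0 < b → 0 < a' → 0 < b' → Nat.Coprime a b → Nat.Coprime a' b' → (d = 1 ∨ Nat.Prime d) → (d' = 1 ∨ Nat.Prime d') → Nat.Coprime d (a * b * (a + b)) → Nat.Coprime d' (a' * b' * (a' + b')) → (d : ℤ) ^ 2 * (freyPair a b).1 = (d' : ℤ) ^ 2 * (freyPair a' b').1 → (d : ℤ) ^ 3 * (freyPair a b).2 = (d' : ℤ) ^ 3 * (freyPair a' b').2 → a = a' ∧ b = b' ∧ d = d' := by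
  intro a b d a' b' d' ha hb ha' hb' hab hab' hd hd' _hdm _hdm' h1 h2
  obtain ⟨hE1, hE2⟩ := twistedFreyPair_eqs h1 h2
  -- Step 1: the twists agree.
  have hdd : d = d' := by
    by_contra hne
    rcases hd with rfl | hdp
    · have hd'p : d'.Prime := hd'.resolve_left fun h => hne h.symm
      exact twistedFreyPair_noCollision hab hd'p (fun h => hne h.symm) (Or.inl rfl) hE1.symm hE2.symm
    · exact twistedFreyPair_noCollision hab' hdp hne hd' hE1 hE2
  subst hdd
  -- Step 2: cancel the (nonzero) twist and recover `(a, b)` from the Frey pair.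
  have hd0 : (d : ℤ) ≠ 0 := by
    rcases hd with rfl | hdp
    · norm_num
    · exact_mod_cast hdp.ne_zero
  have hfst : (freyPair a b).1 = (freyPair a' b').1 := mul_left_cancel₀ (pow_ne_zero 2 hd0) h1
  have hsnd : (freyPair a b).2 = (freyPair a' b').2 := mul_left_cancel₀ (pow_ne_zero 3 hd0) h2
  obtain ⟨h₁, h₂⟩ := freyPair_inj ha hb ha' hb' (Prod.ext hfst hsnd)
  exact ⟨h₁, h₂, rfl⟩

end Summit.ABC.ABC.Theorems.SharpModerateLaw.CuspDispersion

end
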